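import Mathlib
import HarnessLib
import Summits.AtomisticToContinuum.FouriersLaw.Theses.JunctionLocality
import Summits.AtomisticToContinuum.FouriersLaw.Theses.BoundaryEscapeDeficit
import Summits.AtomisticToContinuum.FouriersLaw.Theorems.PhononMeanFreePathBoundaryKubo
import Summits.AtomisticToContinuum.FouriersLaw.Theorems.PhononMeanFreePathBoundaryKuboResponseIdentity
import Summits.AtomisticToContinuum.FouriersLaw.Theorems.JunctionLocalitySuperadditiveResistanceStubLinearResponsePlainAux2
import Summits.AtomisticToContinuum.FouriersLaw.Theorems.JunctionLocalitySuperadditiveResistanceStubPlainKuboLinkAux3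
import Summits.AtomisticToContinuum.FouriersLaw.Theorems.JunctionLocalitySuperadditiveResistanceStubPlainForwardField
import Summits.AtomisticToContinuum.FouriersLaw.Theorems.JunctionLocalitySuperadditiveResistanceKuboPlain

/-!
# Stub `stub_linearResponsePlain` of line `thermalise-then-cut-probe-insertion` — PROVED, with the fixed-`N`
# linear response of the plain chain (crux stmt-AtomisticToContinuum-11748, `JunctionLocality.SuperadditiveResistance`)

The fixed-`N` stub S0a of the skeleton `Cruxes/SuperadditiveResistance/Lines/thermalise_then_cut_probe_insertion.lean`
(v3) asks, under the crux frame, for the plain `L`-chain's response field `h_L` with the Kubo link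
`D_L/(L−1) = γ(1/2 − ⟨p_0² − T, h_L⟩_{μ_T})`. The landed reduction `linearResponsePlain_of_responseIdentity`
(`…StubLinearResponsePlainAux2`, p92444) derives it from the route item `BoundaryEscapeDeficit.ResponseIdentity`
(stmt-AtomisticToContinuum-12237), and that item is now a two-line consequence of two LANDED theorems of route
`PhononMeanFreePath`: `boundaryKubo_proof` (crux `BoundaryKubo`, stmt-AtomisticToContinuum-11812, proved by the line
`gibbs-ttcf`: Gibbs-tested transient time-correlation identity + Harris bounds locally uniform in the bath temperatures)
and `boundaryKubo_iff_responseIdentity` (the zeroth-moment sum rule identifying the two Kubo values). Hence: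

* `responseIdentity_proof : BoundaryEscapeDeficit.ResponseIdentity` — the finite-`N` response identity
  `totalCurrent(μ_{N,T+δ/2,T−δ/2})/δ → (N−1)·γ·E_N` along every unique weak-NESS family (closes item 12237 by name);
* `stub_linearResponsePlain` — the registered stub, verbatim (same namespace as the skeleton);
* `finiteResponseOfUnique_proof : JunctionLocality.FiniteResponseOfUnique` — existence of the response limit for every
  `N` (`N = 0`: the empty chain carries no current), route support item stmt-AtomisticToContinuum-0717;
* `positiveConductance_proof : JunctionLocality.PositiveConductance` — `D_N > 0` for `N ≥ 2`: by uniqueness of limits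
  `D_N = (N−1)·γE_N`, by the Green–Kubo identification (`greenKubo_forwardField`) `γE_N` is the Kubo conductance
  `γ(1 − (γ/T²)⟨g, p_0² − T⟩)` of the left forward field `g` (exists: `stub_plainForwardField`, p82318), and that is
  positive (`KuboPlain.plainKubo_pos`: the `2 × 2` Kubo matrix is an Onsager Laplacian with kernel = constants), route
  support item stmt-AtomisticToContinuum-11750.

No definitions, no named facts; standard axioms.
-/

noncomputable section

open MeasureTheory Filter Topology
open scoped ContDiff
open Literature.MathematicalPhysics.KineticTheory.HeatConduction

namespace Summit.AtomisticToContinuum.FouriersLaw.Cruxes.SuperadditiveResistance.ThermaliseThenCutProbeInsertion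

/-- **The response identity `D_N = (N−1)·γ·E_N` holds** (route item `BoundaryEscapeDeficit.ResponseIdentity`,
stmt-AtomisticToContinuum-12237): under weak-NESS uniqueness, along every steady-state family of
`pinnedChain ω₂ lam β γ` (all `> 0`), for every `T > 0` and `N ≥ 1` the boundary kernel `K_N` is integrable on
`(0,∞)` and `totalCurrent(μ_{N,T+δ/2,T−δ/2})/δ → (N−1)·γ·(1 − (γ/T²)∫₀^∞ K_N)` as `δ → 0`, `δ ≠ 0`. Proof: the landed
cross-form boundary Kubo identity `boundaryKubo_proof` transported by the landed equivalence
`boundaryKubo_iff_responseIdentity`. [cite: KunduDharNarayan2009, arXiv:0809.4543 p. 3]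
[cite: CuneoEckmannHairerReyBellet2018, Thm 2.13] -/
theorem responseIdentity_proof :
    Summit.AtomisticToContinuum.FouriersLaw.Theses.BoundaryEscapeDeficit.ResponseIdentity :=
  Summit.AtomisticToContinuum.FouriersLaw.Theorems.IncoherentBounded.boundaryKubo_iff_responseIdentity.mp
    Summit.AtomisticToContinuum.FouriersLaw.Theorems.PhononMeanFreePathBoundaryKubo.boundaryKubo_proof

/-- **S0a — FIXED-`N` LINEAR RESPONSE OF THE PLAIN CHAIN (registered stub `stub_linearResponsePlain`, PROVED).**
For every length `L ≥ 2` the plain chain's first-order NESS density `h_L` exists, is unique a.e. and represents the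
crux's response coefficient, `D_L/(L−1) = γ(1/2 − ⟨p_0² − T, h_L⟩)`: the landed reduction
`linearResponsePlain_of_responseIdentity` fed with `responseIdentity_proof`.
[cite: ReyBellet2003, Rem. 4.4] [cite: KunduDharNarayan2009, arXiv:0809.4543 p. 3] -/
theorem stub_linearResponsePlain :
    ∀ (ω₂ lam β γ : ℝ) (μ : (N : ℕ) → ℝ → ℝ → Measure (PhaseSpace N)) (T : ℝ) (D : ℕ → ℝ),
      CruxFrame ω₂ lam β γ μ T D →
      ∀ L : ℕ, 2 ≤ L → ∃ h : PhaseSpace L → ℝ,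
          PlainFrame (pinnedChain ω₂ lam β γ) T L h (D L / ((L : ℝ) - 1)) :=
  linearResponsePlain_of_responseIdentity responseIdentity_proof

/-- **Existence of the finite-`N` response limit** (route support item `JunctionLocality.FiniteResponseOfUnique`,
stmt-AtomisticToContinuum-0717): under weak-NESS uniqueness, along every steady-state family, for every `T > 0` and
every `N` the limit `lim_{δ→0, δ≠0} totalCurrent(μ_{N,T+δ/2,T−δ/2})/δ` exists. For `N ≥ 1` it is the value of
`responseIdentity_proof`; for `N = 0` the empty chain carries no current. [cite: ReyBellet2003, Rem. 4.4] -/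
theorem finiteResponseOfUnique_proof :
    Summit.AtomisticToContinuum.FouriersLaw.Theses.JunctionLocality.FiniteResponseOfUnique := by
  intro ω₂ lam β γ hω hl hβ hγ hU μ hμ T hT N
  rcases Nat.eq_zero_or_pos N with rfl | hN
  · refine ⟨0, ?_⟩
    refine (tendsto_const_nhds (x := (0 : ℝ))).congr' ?_
    filter_upwards with δ
    simp [OscillatorChain.totalCurrent_zero]
  · have h := responseIdentity_proof ω₂ lam β γ hω hl hβ hγ hU μ hμ T hT
    dsimp only at h
    obtain ⟨-, hlim⟩ := h N hN
    exact ⟨_, hlim⟩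

/-- **Positive conductance at every finite length** (route support item `JunctionLocality.PositiveConductance`,
stmt-AtomisticToContinuum-11750): under weak-NESS uniqueness, along every steady-state family, for every `T > 0`
and response coefficients `D`, `D_N > 0` for all `N ≥ 2`. Proof: by uniqueness of limits along `𝓝[≠] 0`,
`D_N = (N−1)·γ·E_N` (`responseIdentity_proof`); for the left forward field `g` of the plain `N`-chain
(`stub_plainForwardField`) the Green–Kubo identification `⟨g, p_0² − T⟩_{μ_T} = ∫₀^∞ K_N` (`greenKubo_forwardField`)
turns `γE_N` into the Kubo conductance `γ(1 − (γ/T²)⟨g, p_0² − T⟩)`, which is positive (`KuboPlain.plainKubo_pos`).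
[cite: ReyBellet2003, Rem. 4.4] [cite: EckmannPilletReyBellet1999b, Thm 'entropy'] -/
theorem positiveConductance_proof :
    Summit.AtomisticToContinuum.FouriersLaw.Theses.JunctionLocality.PositiveConductance := by
  intro ω₂ lam β γ hω hl hβ hγ hU μ hμ T hT D hD N hN
  have hN0 : 0 < N := by omega
  -- the value of the response limit at `N`
  have h := responseIdentity_proof ω₂ lam β γ hω hl hβ hγ hU μ hμ T hT
  dsimp only at h
  obtain ⟨-, hlim⟩ := h N hN0
  simp only [dif_pos hN0] at hlim
  have hDN := tendsto_nhds_unique (hD N) hlim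
  -- the left forward field of the plain `N`-chain and its Green–Kubo identification
  obtain ⟨g, hgC, hgL2, hgmean, hgpde⟩ :=
    FloatingProbeBypassLaplacian.stub_plainForwardField ω₂ lam β γ T hω hl hβ hγ hT N hN
  have hGK := FloatingProbeBypassLaplacian.greenKubo_forwardField hω hl.le hβ hγ hN0 hT hgC hgL2 hgmean hgpde
  -- positivity of the Kubo conductance
  have hpos := Summit.AtomisticToContinuum.FouriersLaw.Theorems.SuperadditiveResistance.KuboPlain.plainKubo_pos
    ω₂ lam β γ T hω hl hβ hγ hT N hN g ⟨hgC, hgL2, hgmean, hgpde⟩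
  unfold Summit.AtomisticToContinuum.FouriersLaw.Theorems.SuperadditiveResistance.KuboPlain.plainKubo at hpos
  rw [hGK] at hpos
  have hN1 : (0 : ℝ) < (N : ℝ) - 1 := by
    have : (2 : ℝ) ≤ (N : ℝ) := by exact_mod_cast hN
    linarith
  rw [hDN]
  have e : ((N : ℝ) - 1) * γ * (1 - γ / T ^ 2 * ∫ u in Set.Ioi (0 : ℝ), ∫ z, (z.2 ⟨0, hN0⟩ ^ 2 - T) *
      (∫ y, (y.2 ⟨0, hN0⟩ ^ 2 - T) ∂((pinnedChain ω₂ lam β γ).transitionKernel N T T u.toNNReal z))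
      ∂((pinnedChain ω₂ lam β γ).gibbsMeasure N T)) =
      ((N : ℝ) - 1) * (γ * (1 - γ / T ^ 2 * ∫ u in Set.Ioi (0 : ℝ), ∫ z, (z.2 ⟨0, hN0⟩ ^ 2 - T) *
      (∫ y, (y.2 ⟨0, hN0⟩ ^ 2 - T) ∂((pinnedChain ω₂ lam β γ).transitionKernel N T T u.toNNReal z))
      ∂((pinnedChain ω₂ lam β γ).gibbsMeasure N T))) := by ring
  rw [e]
  exact mul_pos hN1 hpos

end Summit.AtomisticToContinuum.FouriersLaw.Cruxes.SuperadditiveResistance.ThermaliseThenCutProbeInsertion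

end
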